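import Mathlib.MeasureTheory.Measure.GiryMonad
import Literature.MathematicalPhysics.KineticTheory.InfiniteChainSpecificationLocality
import Literature.Probability.LatticeModels.MarkovWindowDensity
import Literature.Probability.LatticeModels.GibbsSpecificationTilted
import HarnessLib

/-!
# Markov-chain measures with transfer-kernel window densities are DLR Gibbs states of the chain

Topic `Literature/MathematicalPhysics/KineticTheory`; theorems only (no definitions, no named
facts). Companion of `InfiniteChainSpecificationDensity.lean` / `InfiniteChainSpecificationLocality.lean`
(the kernels `γ_Λ(· | η)` of `OscillatorChain.chainSpecification P T` as ratios of marginal integrals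
`(∫⋯∫⁻_Λ 𝟙_A e^{-H_Λ/T}) / (∫⋯∫⁻_Λ e^{-H_Λ/T})`, measurable and `Λᶜ`-local in `η`) and of
`Literature.Probability.LatticeModels.MarkovWindowDensity` (window densities
`D a n σ = φ(σ_a) φ(σ_{a+n}) ∏ (k L⁻¹) ∏ w` of a two-sided stationary Markov chain).

**The DLR step of the transfer-operator construction** (Georgii 2011, Thm 10.25 / §11.1 and
Remark 1.24; for the anharmonic chain: Cassandro–Olivieri–Pellegrinotti–Presutti 1978, §2): if the
Boltzmann weight of the chain factorises as `e^{-H_Λ/T} = ∏_{x∈Λ} w(σ_x) ∏_{y∈bondSet Λ} k(σ_y, σ_{y+1})`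
(sites and bonds meeting `Λ`), and a probability measure `μ` on `ℤ → ℝ × ℝ` integrates every
observable depending on a window `{a,…,a+n}` to `∫⋯∫⁻ Φ · D a n`, then `μ` satisfies the DLR
equations for EVERY finite `Λ` (not only intervals): inside a window containing `Λ`, its
neighbours and the support of a cylinder event `A`, the window density splits as
`D = e^{-H_Λ/T} · G` with `G` independent of the spins in `Λ`, so
`∫⋯∫⁻_Λ γ_Λ(A|·) D = γ_Λ(A|·) G Z_Λ = G ∫⋯∫⁻_Λ 𝟙_A e^{-H_Λ/T} = ∫⋯∫⁻_Λ 𝟙_A D`; integrating the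
remaining coordinates gives `∫ γ_Λ(A|η) dμ = μ(A)` on cylinders, and a π-λ argument finishes.
No eigen-equation is used here (only the algebraic form of `D`).

* `mem_bondSet_iff`, `prod_range_eq_prod_mul_prod_filter` — bookkeeping;
* `windowDensity_eq_boltzmann_mul` — the factorisation `D a n = e^{-H_Λ/T} · G`, `G ⫫ Λ`;
* `lintegral_chainSpecification_cylinder_eq` — DLR on cylinder events;
* `isChainGibbsMeasure_of_windowDensity` — **DLR for all measurable sets**.

[cite: Georgii2011, Thm 10.25 and §11.1]
-/

noncomputable section

open MeasureTheory Set Function Finset Literature.Probability.LatticeModels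
open scoped ENNReal

namespace Literature.MathematicalPhysics.KineticTheory.HeatConduction

namespace OscillatorChain

variable (P : OscillatorChain)

/-! ### Bookkeeping -/

omit P in
/-- `y ∈ bondSet Λ ↔ y ∈ Λ ∨ y + 1 ∈ Λ`. [folklore] -/
theorem mem_bondSet_iff {Λ : Finset ℤ} {y : ℤ} : y ∈ bondSet Λ ↔ y ∈ Λ ∨ y + 1 ∈ Λ := by
  simp only [bondSet, Finset.mem_union, Finset.mem_image]
  constructor
  · rintro (h | ⟨x, hx, rfl⟩)
    · exact Or.inl h
    · right; simpa using hx
  · rintro (h | h)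
    · exact Or.inl h
    · exact Or.inr ⟨y + 1, h, by ring⟩

omit P in
/-- Splitting a product over the sites `a, …, a+m-1` into the part over a subset `T` and the rest.
[folklore] -/
theorem prod_range_eq_prod_mul_prod_filter {M : Type*} [CommMonoid M] (f : ℤ → M) (a : ℤ) (m : ℕ)
    {T : Finset ℤ} (hT : ∀ x ∈ T, a ≤ x ∧ x < a + m) :
    ∏ j ∈ Finset.range m, f (a + j) =
      (∏ x ∈ T, f x) * ∏ j ∈ (Finset.range m).filter (fun j : ℕ => a + (j : ℤ) ∉ T), f (a + j) := by
  classical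
  rw [← Finset.prod_filter_mul_prod_filter_not (Finset.range m) (fun j : ℕ => a + (j : ℤ) ∈ T)]
  congr 1
  refine Finset.prod_nbij' (fun j : ℕ => a + (j : ℤ)) (fun x : ℤ => (x - a).toNat) ?_ ?_ ?_ ?_ ?_
  · intro j hj
    exact (Finset.mem_filter.1 hj).2
  · intro x hx
    obtain ⟨h1, h2⟩ := hT x hx
    refine Finset.mem_filter.2 ⟨Finset.mem_range.2 (by omega), ?_⟩
    rw [Int.toNat_of_nonneg (by omega), add_sub_cancel]
    exact hx
  · intro j _
    simp
  · intro x hx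
    obtain ⟨h1, -⟩ := hT x hx
    rw [Int.toNat_of_nonneg (by omega), add_sub_cancel]
  · intro j _
    rfl

/-! ### The factorisation of the window density along a finite volume -/

omit P in
/-- **`D a n = e^{-H_Λ/T} · G` with `G` independent of the spins in `Λ`.** If the Boltzmann weight
factorises into site and bond factors and `Λ` lies strictly inside the window `{a, …, a+n}`, the
window density is the Boltzmann weight of `Λ` times a measurable function depending only on the
coordinates off `Λ` (and inside the window). [cite: Georgii2011, Thm 10.25 and §11.1] -/
theorem windowDensity_eq_boltzmann_mul {k : ℝ × ℝ → ℝ × ℝ → ℝ≥0∞} {φ w : ℝ × ℝ → ℝ≥0∞}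
    {L : ℝ≥0∞} {D : ℤ → ℕ → ChainConfig → ℝ≥0∞} {B : ChainConfig → ℝ≥0∞} {Λ : Finset ℤ}
    (hk : Measurable (uncurry k)) (hφ : Measurable φ) (hw : Measurable w)
    (hD : ∀ a n σ, D a n σ = φ (σ a) * φ (σ (a + n)) *
      (∏ j ∈ Finset.range n, k (σ (a + j)) (σ (a + j + 1)) * L⁻¹) *
      ∏ j ∈ Finset.range (n + 1), w (σ (a + j)))
    (hB : ∀ σ, B σ = (∏ x ∈ Λ, w (σ x)) * ∏ y ∈ bondSet Λ, k (σ y) (σ (y + 1)))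
    {a : ℤ} {n : ℕ} (hΛ : ∀ x ∈ Λ, a < x ∧ x < a + n) :
    ∃ G : ChainConfig → ℝ≥0∞, Measurable G ∧ DependsOn G ((↑Λ : Set ℤ)ᶜ) ∧
      DependsOn G (↑(Finset.Icc a (a + n)) : Set ℤ) ∧ ∀ σ, D a n σ = B σ * G σ := by
  classical
  have hbond : ∀ y ∈ bondSet Λ, a ≤ y ∧ y < a + n := fun y hy => by
    rcases mem_bondSet_iff.1 hy with h | h
    · have := hΛ y h; omega
    · have := hΛ (y + 1) h; omega
  have hsite : ∀ x ∈ Λ, a ≤ x ∧ x < a + ↑(n + 1) := fun x hx => by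
    have := hΛ x hx; push_cast; omega
  refine ⟨fun σ => φ (σ a) * φ (σ (a + n)) * (L⁻¹) ^ n *
      (∏ j ∈ (Finset.range n).filter (fun j : ℕ => a + (j : ℤ) ∉ bondSet Λ),
        k (σ (a + j)) (σ (a + j + 1))) *
      ∏ j ∈ (Finset.range (n + 1)).filter (fun j : ℕ => a + (j : ℤ) ∉ Λ), w (σ (a + j)),
    ?_, ?_, ?_, fun σ => ?_⟩
  · refine ((((measurable_comp_eval hφ a).mul (measurable_comp_eval hφ _)).mul
      measurable_const).mul (Finset.measurable_prod _ fun j _ => measurable_kernel_eval hk _ _)).mul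
      (Finset.measurable_prod _ fun j _ => measurable_comp_eval hw _)
  · intro x y hxy
    have hxy' : ∀ i, i ∉ Λ → x i = y i := fun i hi => hxy i (by simpa using hi)
    have ha : a ∉ Λ := fun h => by have := hΛ a h; omega
    have hb : a + (n : ℤ) ∉ Λ := fun h => by have := hΛ _ h; omega
    have hK : ∏ j ∈ (Finset.range n).filter (fun j : ℕ => a + (j : ℤ) ∉ bondSet Λ),
        k (x (a + j)) (x (a + j + 1)) =
        ∏ j ∈ (Finset.range n).filter (fun j : ℕ => a + (j : ℤ) ∉ bondSet Λ),
          k (y (a + j)) (y (a + j + 1)) := by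
      refine Finset.prod_congr rfl fun j hj => ?_
      have hj' := (Finset.mem_filter.1 hj).2
      rw [mem_bondSet_iff, not_or] at hj'
      rw [hxy' _ hj'.1, hxy' _ hj'.2]
    have hW : ∏ j ∈ (Finset.range (n + 1)).filter (fun j : ℕ => a + (j : ℤ) ∉ Λ), w (x (a + j)) =
        ∏ j ∈ (Finset.range (n + 1)).filter (fun j : ℕ => a + (j : ℤ) ∉ Λ), w (y (a + j)) :=
      Finset.prod_congr rfl fun j hj => by rw [hxy' _ (Finset.mem_filter.1 hj).2]
    dsimp only
    rw [hxy' a ha, hxy' _ hb, hK, hW]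
  · intro x y hxy
    simp only [Finset.coe_Icc, Set.mem_Icc] at hxy
    have hK : ∏ j ∈ (Finset.range n).filter (fun j : ℕ => a + (j : ℤ) ∉ bondSet Λ),
        k (x (a + j)) (x (a + j + 1)) =
        ∏ j ∈ (Finset.range n).filter (fun j : ℕ => a + (j : ℤ) ∉ bondSet Λ),
          k (y (a + j)) (y (a + j + 1)) := by
      refine Finset.prod_congr rfl fun j hj => ?_
      have hj' := Finset.mem_range.1 (Finset.mem_filter.1 hj).1
      rw [hxy (a + j) ⟨by omega, by omega⟩, hxy (a + j + 1) ⟨by omega, by omega⟩]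
    have hW : ∏ j ∈ (Finset.range (n + 1)).filter (fun j : ℕ => a + (j : ℤ) ∉ Λ), w (x (a + j)) =
        ∏ j ∈ (Finset.range (n + 1)).filter (fun j : ℕ => a + (j : ℤ) ∉ Λ), w (y (a + j)) := by
      refine Finset.prod_congr rfl fun j hj => ?_
      have hj' := Finset.mem_range.1 (Finset.mem_filter.1 hj).1
      rw [hxy (a + j) ⟨by omega, by omega⟩]
    dsimp only
    rw [hxy a ⟨le_rfl, by omega⟩, hxy (a + n) ⟨by omega, le_rfl⟩, hK, hW]
  · rw [hD, hB, Finset.prod_mul_distrib, Finset.prod_const, Finset.card_range,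
      prod_range_eq_prod_mul_prod_filter (fun y => k (σ y) (σ (y + 1))) a n hbond,
      prod_range_eq_prod_mul_prod_filter (fun x => w (σ x)) a (n + 1) hsite]
    ring

/-! ### The DLR equations -/

/-- **DLR on cylinder events.** Under the factorisation of the Boltzmann weight and the window
formula for `μ`, `∫ γ_Λ(A | η) dμ(η) = μ(A)` for every finite `Λ` and every measurable cylinder
event `A`. [cite: Georgii2011, Thm 10.25 and §11.1] -/
theorem lintegral_chainSpecification_cylinder_eq (hU : Measurable P.U) (hV : Measurable P.V)
    {T : ℝ} {k : ℝ × ℝ → ℝ × ℝ → ℝ≥0∞} {φ w : ℝ × ℝ → ℝ≥0∞} {L : ℝ≥0∞}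
    {D : ℤ → ℕ → ChainConfig → ℝ≥0∞}
    (hk : Measurable (uncurry k)) (hφ : Measurable φ) (hw : Measurable w)
    (hD : ∀ a n σ, D a n σ = φ (σ a) * φ (σ (a + n)) *
      (∏ j ∈ Finset.range n, k (σ (a + j)) (σ (a + j + 1)) * L⁻¹) *
      ∏ j ∈ Finset.range (n + 1), w (σ (a + j)))
    (hfac : ∀ (Λ : Finset ℤ) (σ : ChainConfig),
      ENNReal.ofReal (Real.exp (-T⁻¹ * hamiltonianIn P.chainPotential chainSupp Λ σ)) =
        (∏ x ∈ Λ, w (σ x)) * ∏ y ∈ bondSet Λ, k (σ y) (σ (y + 1)))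
    (hZ : ∀ (Λ : Finset ℤ) (η : ChainConfig), (∫⋯∫⁻_Λ, (fun σ =>
        ENNReal.ofReal (Real.exp (-T⁻¹ * hamiltonianIn P.chainPotential chainSupp Λ σ)))
      ∂fun _ : ℤ => (volume : Measure (ℝ × ℝ))) η ≠ ∞)
    {μ : Measure ChainConfig}
    (hμ : ∀ (a : ℤ) (n : ℕ) (Φ : ChainConfig → ℝ≥0∞), Measurable Φ →
      DependsOn Φ (↑(Finset.Icc a (a + n)) : Set ℤ) → ∀ η : ChainConfig,
        ∫⁻ σ, Φ σ ∂μ = (∫⋯∫⁻_Finset.Icc a (a + n), (fun σ => Φ σ * D a n σ)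
          ∂fun _ : ℤ => (volume : Measure (ℝ × ℝ))) η)
    (Λ I : Finset ℤ) {C : Set (↥I → ℝ × ℝ)} (hC : MeasurableSet C) :
    ∫⁻ η, P.chainSpecification T Λ η (cylinder I C) ∂μ = μ (cylinder I C) := by
  classical
  -- notation
  set Bw : ChainConfig → ℝ≥0∞ := fun σ =>
    ENNReal.ofReal (Real.exp (-T⁻¹ * hamiltonianIn P.chainPotential chainSupp Λ σ)) with hBw
  set A : Set ChainConfig := cylinder I C with hAdef
  have hA : MeasurableSet A := MeasurableSet.cylinder I hC
  have hBm : Measurable Bw := P.measurable_boltzmannWeight hU hV T Λ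
  set q : ChainConfig → ℝ≥0∞ := fun η => P.chainSpecification T Λ η A with hq
  have hqm : Measurable q := P.measurable_chainSpecification_apply hU hV T Λ hA
  -- a window `{a, …, a+n}` containing `I` and, strictly inside, `Λ`
  set N : ℕ := (Λ ∪ I).sup Int.natAbs + 1 with hN
  set a : ℤ := -(N : ℤ) with ha
  set n : ℕ := 2 * N with hn
  have hmemN : ∀ x ∈ Λ ∪ I, x.natAbs + 1 ≤ N := fun x hx => by
    have := Finset.le_sup (f := Int.natAbs) hx
    rw [hN]; omega
  have hΛ : ∀ x ∈ Λ, a < x ∧ x < a + n := fun x hx => by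
    have := hmemN x (Finset.mem_union_left _ hx)
    rw [ha, hn]; push_cast; omega
  have hI : I ⊆ Finset.Icc a (a + n) := fun x hx => by
    have := hmemN x (Finset.mem_union_right _ hx)
    simp only [Finset.mem_Icc]; rw [ha, hn]; push_cast; omega
  have hΛsub : Λ ⊆ Finset.Icc a (a + n) := fun x hx => by
    have := hΛ x hx; simp only [Finset.mem_Icc]; omega
  -- the factorisation `D a n = Bw * G`
  obtain ⟨G, hGm, hGΛ, hGwin, hDG⟩ := windowDensity_eq_boltzmann_mul (Λ := Λ) hk hφ hw hD
    (fun σ => hfac Λ σ) hΛ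
  -- dependence of the integrands
  have hAind : DependsOn (A.indicator (1 : ChainConfig → ℝ≥0∞)) (↑I : Set ℤ) := fun x y hxy =>
    dependsOn_cylinder_indicator_const C (1 : ℝ≥0∞) hxy
  have hBdep : DependsOn Bw (↑(Finset.Icc a (a + n)) : Set ℤ) := by
    intro x y hxy
    simp only [Finset.coe_Icc, Set.mem_Icc] at hxy
    rw [hBw]
    dsimp only
    rw [hfac, hfac]
    congr 1
    · exact Finset.prod_congr rfl fun x' hx' => by
        have := hΛ x' hx'; rw [hxy x' ⟨by omega, by omega⟩]
    · refine Finset.prod_congr rfl fun y hy => ?_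
      rcases mem_bondSet_iff.1 hy with h | h
      · have := hΛ y h
        rw [hxy y ⟨by omega, by omega⟩, hxy (y + 1) ⟨by omega, by omega⟩]
      · have := hΛ (y + 1) h
        rw [hxy y ⟨by omega, by omega⟩, hxy (y + 1) ⟨by omega, by omega⟩]
  have hNdep : DependsOn (fun σ => A.indicator 1 σ * Bw σ) (↑(Finset.Icc a (a + n)) : Set ℤ) :=
    fun x y hxy => by
      dsimp only
      rw [hAind.mono (fun i hi => Finset.mem_coe.2 (hI (Finset.mem_coe.1 hi))) hxy, hBdep hxy]
  have hqdep : DependsOn q (↑(Finset.Icc a (a + n)) : Set ℤ) := by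
    intro x y hxy
    rw [hq]
    dsimp only
    rw [P.chainSpecification_apply_eq_lmarginal_div hU hV T Λ x hA,
      P.chainSpecification_apply_eq_lmarginal_div hU hV T Λ y hA,
      (dependsOn_lmarginal (μ := fun _ : ℤ => (volume : Measure (ℝ × ℝ))) Λ hNdep).mono
        sdiff_subset hxy,
      (dependsOn_lmarginal (μ := fun _ : ℤ => (volume : Measure (ℝ × ℝ))) Λ hBdep).mono
        sdiff_subset hxy]
  have hqdepΛ : DependsOn q ((↑Λ : Set ℤ)ᶜ) := P.dependsOn_chainSpecification_apply hU hV T Λ hA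
  -- the fibre identity `∫⋯∫⁻_Λ q D = ∫⋯∫⁻_Λ 𝟙_A D`
  have hfib : (∫⋯∫⁻_Λ, (fun σ => q σ * D a n σ) ∂fun _ : ℤ => (volume : Measure (ℝ × ℝ))) =
      ∫⋯∫⁻_Λ, (fun σ => A.indicator 1 σ * D a n σ) ∂fun _ : ℤ => (volume : Measure (ℝ × ℝ)) := by
    have h1 : (fun σ => q σ * D a n σ) = fun σ => Bw σ * G σ * q σ := funext fun σ => by
      rw [hDG]; ring
    have h2 : (fun σ => A.indicator 1 σ * D a n σ) = fun σ => Bw σ * G σ * A.indicator 1 σ :=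
      funext fun σ => by rw [hDG]; ring
    rw [h1, h2]
    refine lmarginal_mul_mul_eq_of_dependsOn _ Λ hBm (measurable_one.indicator hA) hGΛ hqdepΛ
      fun ρ => ?_
    rw [hq]
    dsimp only
    rw [P.chainSpecification_apply_eq_lmarginal_div hU hV T Λ ρ hA]
    rw [ENNReal.mul_div_cancel (P.lmarginal_boltzmann_pos hU hV T Λ ρ).ne' (hZ Λ ρ),
      show (fun σ => A.indicator 1 σ * Bw σ) = fun τ => Bw τ * A.indicator 1 τ from
        funext fun τ => mul_comm _ _]
  -- assemble
  have hunion : Finset.Icc a (a + n) = (Finset.Icc a (a + n) \ Λ) ∪ Λ :=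
    (Finset.sdiff_union_of_subset hΛsub).symm
  have hdisj : Disjoint (Finset.Icc a (a + n) \ Λ) Λ := Finset.sdiff_disjoint
  set η₀ : ChainConfig := fun _ => (0, 0) with hη₀
  calc ∫⁻ η, q η ∂μ
      = (∫⋯∫⁻_Finset.Icc a (a + n), (fun σ => q σ * D a n σ)
          ∂fun _ : ℤ => (volume : Measure (ℝ × ℝ))) η₀ := hμ a n q hqm hqdep η₀
    _ = (∫⋯∫⁻_Finset.Icc a (a + n) \ Λ, ∫⋯∫⁻_Λ, (fun σ => q σ * D a n σ)
          ∂(fun _ : ℤ => (volume : Measure (ℝ × ℝ))) ∂fun _ : ℤ => (volume : Measure (ℝ × ℝ))) η₀ := by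
        conv_lhs => rw [hunion]
        rw [lmarginal_union _ (fun σ => q σ * D a n σ) (hqm.mul (measurable_D hk hφ hw hD a n)) hdisj]
    _ = (∫⋯∫⁻_Finset.Icc a (a + n) \ Λ, ∫⋯∫⁻_Λ, (fun σ => A.indicator 1 σ * D a n σ)
          ∂(fun _ : ℤ => (volume : Measure (ℝ × ℝ))) ∂fun _ : ℤ => (volume : Measure (ℝ × ℝ))) η₀ := by
        rw [hfib]
    _ = (∫⋯∫⁻_Finset.Icc a (a + n), (fun σ => A.indicator 1 σ * D a n σ)
          ∂fun _ : ℤ => (volume : Measure (ℝ × ℝ))) η₀ := by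
        conv_rhs => rw [hunion]
        rw [lmarginal_union _ (fun σ => A.indicator 1 σ * D a n σ)
          ((measurable_one.indicator hA).mul (measurable_D hk hφ hw hD a n)) hdisj]
    _ = ∫⁻ σ, A.indicator 1 σ ∂μ :=
        (hμ a n _ (measurable_one.indicator hA)
          (hAind.mono fun i hi => Finset.mem_coe.2 (hI (Finset.mem_coe.1 hi))) η₀).symm
    _ = μ A := lintegral_indicator_one hA

/-- **Markov-chain measures with transfer-kernel window densities are Gibbs states of the chain.**
Let `U`, `V` be measurable, the Boltzmann weights factorise as
`e^{-H_Λ/T} = ∏_{x∈Λ} w(σ_x) ∏_{y∈bondSet Λ} k(σ_y, σ_{y+1})`, the normalisers be finite, and let the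
probability measure `μ` integrate window observables against the window densities `D a n` of
`k, φ, w, L`. Then `μ` is a DLR Gibbs state of the chain at temperature `T`
(`IsChainGibbsMeasure`): DLR on cylinders (`lintegral_chainSpecification_cylinder_eq`) and the
π-λ theorem on the measurable cylinders. [cite: Georgii2011, Thm 10.25 and §11.1] -/
theorem isChainGibbsMeasure_of_windowDensity (hU : Measurable P.U) (hV : Measurable P.V)
    {T : ℝ} {k : ℝ × ℝ → ℝ × ℝ → ℝ≥0∞} {φ w : ℝ × ℝ → ℝ≥0∞} {L : ℝ≥0∞}
    {D : ℤ → ℕ → ChainConfig → ℝ≥0∞}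
    (hk : Measurable (uncurry k)) (hφ : Measurable φ) (hw : Measurable w)
    (hD : ∀ a n σ, D a n σ = φ (σ a) * φ (σ (a + n)) *
      (∏ j ∈ Finset.range n, k (σ (a + j)) (σ (a + j + 1)) * L⁻¹) *
      ∏ j ∈ Finset.range (n + 1), w (σ (a + j)))
    (hfac : ∀ (Λ : Finset ℤ) (σ : ChainConfig),
      ENNReal.ofReal (Real.exp (-T⁻¹ * hamiltonianIn P.chainPotential chainSupp Λ σ)) =
        (∏ x ∈ Λ, w (σ x)) * ∏ y ∈ bondSet Λ, k (σ y) (σ (y + 1)))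
    (hZ : ∀ (Λ : Finset ℤ) (η : ChainConfig), (∫⋯∫⁻_Λ, (fun σ =>
        ENNReal.ofReal (Real.exp (-T⁻¹ * hamiltonianIn P.chainPotential chainSupp Λ σ)))
      ∂fun _ : ℤ => (volume : Measure (ℝ × ℝ))) η ≠ ∞)
    {μ : Measure ChainConfig} [IsProbabilityMeasure μ]
    (hμ : ∀ (a : ℤ) (n : ℕ) (Φ : ChainConfig → ℝ≥0∞), Measurable Φ →
      DependsOn Φ (↑(Finset.Icc a (a + n)) : Set ℤ) → ∀ η : ChainConfig,
        ∫⁻ σ, Φ σ ∂μ = (∫⋯∫⁻_Finset.Icc a (a + n), (fun σ => Φ σ * D a n σ)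
          ∂fun _ : ℤ => (volume : Measure (ℝ × ℝ))) η) :
    P.IsChainGibbsMeasure T μ := by
  refine ⟨inferInstance, fun Λ A hA => ?_⟩
  -- the measure `A ↦ ∫ γ_Λ(A|η) dμ`
  have hκ : Measurable (P.chainSpecification T Λ) :=
    Measure.measurable_of_measurable_coe _ fun B hB =>
      P.measurable_chainSpecification_apply hU hV T Λ hB
  have hbind : ∀ B : Set ChainConfig, MeasurableSet B →
      (μ.bind (P.chainSpecification T Λ)) B = ∫⁻ η, P.chainSpecification T Λ η B ∂μ := fun B hB =>
    Measure.bind_apply hB hκ.aemeasurable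
  rw [← hbind A hA]
  -- agreement on cylinders, hence everywhere
  have hcyl : ∀ s ∈ measurableCylinders (fun _ : ℤ => ℝ × ℝ),
      (μ.bind (P.chainSpecification T Λ)) s = μ s := by
    intro s hs
    obtain ⟨I, C, hC, rfl⟩ := (mem_measurableCylinders _).1 hs
    rw [hbind _ (MeasurableSet.cylinder I hC)]
    exact P.lintegral_chainSpecification_cylinder_eq hU hV hk hφ hw hD hfac hZ hμ Λ I hC
  have huniv : (μ.bind (P.chainSpecification T Λ)) univ = μ univ := by
    have h := hcyl _ ((mem_measurableCylinders _).2 ⟨∅, univ, MeasurableSet.univ, rfl⟩)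
    rwa [cylinder_univ] at h
  haveI : IsFiniteMeasure (μ.bind (P.chainSpecification T Λ)) :=
    ⟨by rw [huniv]; exact measure_lt_top μ _⟩
  have heq : μ.bind (P.chainSpecification T Λ) = μ :=
    ext_of_generate_finite (measurableCylinders fun _ : ℤ => ℝ × ℝ)
      generateFrom_measurableCylinders.symm isPiSystem_measurableCylinders hcyl huniv
  rw [heq]

end OscillatorChain

end Literature.MathematicalPhysics.KineticTheory.HeatConduction

end
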